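import Mathlib
import Summits.Langlands.Langlands.Theses.PicardMuOrdinary
import Summits.Langlands.Langlands.Theorems.PicardMuOrdinaryIrregularClassicalityDefs
import Literature.NumberTheory.GaloisRepresentations.PicardCurveGaloisRep
import Literature.NumberTheory.Automorphic.BaseChangeCyclicCuspidal
import Literature.NumberTheory.Automorphic.BaseChangeStrongUnramified
import Literature.NumberTheory.Automorphic.BaseChangeArchimedean
import Summits.Langlands.Langlands.Theorems.PicardMuOrdinaryIrregularClassicalityPlaceOfMaximalIdeal
import Summits.Langlands.Langlands.Theorems.PicardMuOrdinaryIrregularClassicalityTwistedPicardGaloisInput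
import Summits.Langlands.Langlands.Theorems.PicardMuOrdinaryIrregularClassicalityBaseChangeToLLinked
import Summits.Langlands.Langlands.Theorems.PicardMuOrdinaryIrregularClassicalityIrregularDescentUntwist
import HarnessLib

/-!
# Route `PicardMuOrdinary`, crux `IrregularClassicality` (stmt-Langlands-13758): the conditional reduction of the line
# `split-ramified-prime-sqrt6`, kernel-checked in the built tree

Continuation lead prover-line-stmt-Langlands-13758-c4-0, 2026-08-16.  Up to now the line's end state lived in crux
WORKFILES (`Cruxes/IrregularClassicality/Lines/split_ramified_prime_sqrt6{,_restated_ord,_route_ord}.lean`: a sorried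
skeleton and two sorry-free certificates that the build never sees).  This file states the same three results as
CONDITIONAL THEOREMS over the vocabulary of `PicardMuOrdinaryIrregularClassicalityDefs.lean`, so that the crux's status
"closed modulo named facts + open statements" is a citable, re-checked fact of the tree:

1. `irregularClassicality_of_stubs` — **the crux BY NAME** (`Theses.PicardMuOrdinary.IrregularClassicality`) from
   (a) the Picard named fact `picardCurve_exists_lambdaAdicRep`, (b) the three Arthur–Clozel base-change facts
   `baseChange_cyclic_cuspidal`, `ArthurClozel1989_strongLifting_unramified`, `ArthurClozel1989_strongLifting_archimedean`,
   and the three OPEN registered stub statements (c) `OrdinaryPolarizedTwistedTowerDebt` (interface debt),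
   (d) `TwoWallOrdinaryClassicalityLinked` (THE open theorem), (e) `BasicRemainder` (conceded λ-basic class) — the
   registered skeleton r9's composition `IrregularClassicality_of` with its five `sorry`s turned into hypotheses; the
   landed Stubs 1 (`stub_placeOfMaximalIdeal`), 2 (`stub_twistedPicardGaloisInput`), 4 (`stub_baseChangeToL_linked`) and
   6 (`stub_irregularDescentUntwist`) do the rest.
2. `irregularClassicalityOrd_of` — **the restated crux** `IrregularClassicalityOrd` from (a), (b) and (d) ONLY: after
   the planner's ordinary twisted-polarized restate of the 13757 → 13758 interface there is no interface stub and no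
   remainder (certificate of leads c1/c3, reshape r8/r9 form: no Harris–Lan–Taylor–Thorne either).
3. `closes_ord` / `picardAutomorphy_of_ord` — **the re-routed deciding theorem** (lead c2's kit):
   `ResidualAutomorphyOdd → ResidualAutomorphyEven → MuOrdinaryFamilyRTOrd → IrregularClassicalityOrd →
   BasicLocusAutomorphy → SectorComplement → Langlands`, checked against the CURRENT route file; plus the
   no-refutation-room lemmas (13758ᵒʳᵈ and the third branch are weakenings of the target `PicardAutomorphy`; for the
   crux itself this is the refuter's landed `target_implies_crux` reading) and the read-back `irregularClassicality_iff`.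

Nothing here closes the item: every theorem is conditional (the gate records the trust base).  What would close it:
`_holds` theorems for (a), (b) in Literature and proofs of (c), (d), (e) — of which (c) is discharged by the restate,
(d) is crux-sized (promote), (e) is the conceded third branch.
-/

-- `Summit.Langlands.Langlands.…` (summit = sub-problem name, D-0017 layout) trips `dupNamespace` on every decl.
set_option linter.dupNamespace false
set_option autoImplicit false

namespace Summit.Langlands.Langlands.Theorems.IrregularClassicality.SplitRamifiedPrimeSqrt6

open scoped NumberField Polynomial Classical
open IsDedekindDomain NumberField Polynomial
open Literature.NumberTheory.GaloisRepresentations Literature.NumberTheory.Automorphic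
open Summit.Langlands.Langlands.Theses.PicardMuOrdinary

noncomputable section

/-! ## 1. Read-back and refutation room -/

/-- The crux, read back symbol by symbol: it is definitionally `LimitHypothesis → AutomorphyConclusion` over generic
quartics. -/
theorem irregularClassicality_iff :
    IrregularClassicality ↔
      ∀ (f : ℤ[X]) (hcpt : isCompact_glFiniteIntegralLevel 3 (CyclotomicField 3 ℚ)), f.natDegree = 4 →
        (f.map (Int.castRingHom ℚ)).Separable → 12 ∣ Nat.card (f.map (Int.castRingHom ℚ)).Gal →
        LimitHypothesis f hcpt → AutomorphyConclusion f hcpt :=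
  Iff.rfl

/-- 13758ᵒʳᵈ is a weakening of the target (no refutation room). -/
theorem irregularClassicalityOrd_of_picardAutomorphy (hX : PicardAutomorphy) : IrregularClassicalityOrd :=
  fun _ f hcpt hdeg hsep hgal _ => hX f hcpt hdeg hsep hgal

/-- The third branch is a weakening of the target (no refutation room). -/
theorem basicLocusAutomorphy_of_picardAutomorphy (hX : PicardAutomorphy) : BasicLocusAutomorphy :=
  fun _ f hcpt hdeg hsep hgal _ _ => hX f hcpt hdeg hsep hgal

/-! ## 2. The crux by name, from the named facts and the three open stub statements -/

/-- **The line concludes the crux, conditionally** (registered skeleton r9, its five `sorry`s as hypotheses).  Unpack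
the typed tower `(e, 𝔐, S, (P_k))`; Stub 1 (landed) turns `𝔐` into an adapted `ι : ℚ̄₃ ≃ ℂ`; Stub 2 (landed, on the
Picard fact) gives the primary generators `ϖ` off `S₀ ⊇ {v ∣ 3}` and `ρ = ρ'_C` through `(ι, e)`; CASE SPLIT on the
ALIGNED μ-ordinarity of `ρ` (`∃ art, MuOrdinaryGaloisGuard art ρ`).  μ-ORDINARY: the interface debt produces the ordinary
exactly polarized tower with its avatars; Stub 4 (landed in linked form, on the three Arthur–Clozel facts) supplies
`L = K(√-2)`, the level `S_L` and the base-change map on tower members; the heart (fed the ordinary tower AND the map)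
makes `ρ` automorphic over `K`.  λ-BASIC: the conceded remainder.  In both cases Stub 6 (landed, unconditional)
untwists to a cuspidal L-algebraic `π_K` with `ΣSat(π_K,𝔭) = e(a_𝔭(f))` a.e. -/
theorem irregularClassicality_of_stubs :
    picardCurve_exists_lambdaAdicRep → baseChange_cyclic_cuspidal →
    ArthurClozel1989_strongLifting_unramified → ArthurClozel1989_strongLifting_archimedean →
    OrdinaryPolarizedTwistedTowerDebt → TwoWallOrdinaryClassicalityLinked → BasicRemainder →
    IrregularClassicality := by
  intro hPic hBCc hBCu hBCa hDebt hHeart hRem f hcpt hdeg hsep hgal hlim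
  classical
  obtain ⟨e, 𝔐, S, h𝔐, h3, htower⟩ := hlim
  -- Stub 1: the place 𝔐 is the place of an isomorphism ι : ℚ̄₃ ≃ ℂ
  obtain ⟨ι, hι⟩ := stub_placeOfMaximalIdeal 𝔐 h𝔐 h3
  -- Stub 2: primary generators and the twisted Picard representation through (ι, e)
  obtain ⟨S₀, ϖ, ρ, hS₀, hirr, hρ⟩ := stub_twistedPicardGaloisInput hPic f hdeg hsep hgal ι e
  -- case split on the μ-ordinarity of ρ at λ
  by_cases hg : ∃ art : ArtinData, MuOrdinaryGaloisGuard art ρ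
  · obtain ⟨art, hg⟩ := hg
    -- the interface debt: the ORDINARY exactly polarized tower for the twisted traces
    obtain ⟨c₀, S', hc₀, -, hS₀S', hord⟩ :=
      hDebt f hcpt hdeg hsep hgal art ι e 𝔐 S S₀ ϖ ρ h𝔐 h3 hι hρ hg htower
    -- Stub 4 (linked form): the base change to L = K(√-2) as a map on tower members
    obtain ⟨L, _instF, _instNF, _instA, s, c, hcptL, S_L, hCM, hs, hdegL, hcs, hcc₀, hSL3, hSLS₀, hSLS, hBCmap⟩ :=
      stub_baseChangeToL_linked hBCc hBCu hBCa ι hcpt c₀ hc₀ S' S₀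
        (fun 𝔭 => e (↑(picardTrace f 𝔭 * ϖ 𝔭))) ρ hS₀ (fun 𝔭 h𝔭 => (hρ 𝔭 h𝔭).2)
    -- the heart: ρ is automorphic over K
    obtain ⟨π', S'', hLalg, hcompat⟩ :=
      hHeart art f hcpt hdeg hsep hgal ι e S₀ ϖ ρ hS₀ hρ c₀ S' hord hS₀S' L s c hcptL S_L hCM hc₀ hs hdegL hcs hcc₀
        (hirr L hdegL) hSL3 hSLS₀ hSLS hBCmap
    -- Stub 6: untwist, in sum form
    obtain ⟨πK, hKalg, hev⟩ :=
      stub_irregularDescentUntwist f hcpt hdeg hsep hgal ι e S₀ ϖ ρ hS₀ hρ π' S'' hLalg hcompat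
    exact ⟨e, πK, hKalg, hev⟩
  · push Not at hg
    -- the conceded λ-basic remainder
    obtain ⟨π', S'', hLalg, hcompat⟩ := hRem f hcpt hdeg hsep hgal ι e S₀ ϖ ρ hS₀ hρ hg 𝔐 S h𝔐 h3 hι htower
    -- Stub 6: untwist, in sum form
    obtain ⟨πK, hKalg, hev⟩ :=
      stub_irregularDescentUntwist f hcpt hdeg hsep hgal ι e S₀ ϖ ρ hS₀ hρ π' S'' hLalg hcompat
    exact ⟨e, πK, hKalg, hev⟩

/-! ## 3. The restated crux from the named facts and the heart only -/

/-- **The certificate of the ordinary restate** (leads c1/c3).  The landed stubs close `IrregularClassicalityOrd`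
modulo (a) the Picard named fact, (b) the THREE Arthur–Clozel base-change facts, (c) the linked heart — nothing else:
no interface stub, no remainder stub, no `exists_galoisRep_of_regularAlgebraic`.  Proof: unpack
`(e, ι, S, c₀, ϖ, (Π_k, r_k))`; Stub 2 gives `S₀ ⊇ {v ∣ 3}`, primary generators `ϖ'` off `S₀` and `ρ = ρ_C ⊗ ψ` read
through `(ι, e)`; by `primaryGen_unique` (landed) `ϖ = ϖ'` off `S ∪ S₀`, so the given tower is an ordinary polarized
tower for the trace function of `ρ` off `S ∪ S₀`; Stub 4 in LINKED form supplies `L = K(√-2)`, `S_L` and the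
base-change map on members; the linked heart makes `ρ` automorphic over `K`; Stub 6 untwists in sum form. -/
theorem irregularClassicalityOrd_of :
    picardCurve_exists_lambdaAdicRep → baseChange_cyclic_cuspidal →
    ArthurClozel1989_strongLifting_unramified → ArthurClozel1989_strongLifting_archimedean →
    TwoWallOrdinaryClassicalityLinked → IrregularClassicalityOrd := by
  intro hPic hBCc hBCu hBCa hHeart art f hcpt hdeg hsep hgal hyp
  classical
  obtain ⟨e, ι, S, c₀, ϖ, hc₀, hϖ, htower⟩ := hyp
  -- Stub 2 (landed, conditional on the Picard named fact): S₀, primary generators ϖ', ρ = ρ_C ⊗ ψ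
  obtain ⟨S₀, ϖ', ρ, hS₀, hirr, hρ⟩ := stub_twistedPicardGaloisInput hPic f hdeg hsep hgal ι e
  -- primary generators agree off `S ∪ S₀`
  have hϖeq : ∀ 𝔭, 𝔭 ∉ S ∪ S₀ → ϖ 𝔭 = ϖ' 𝔭 := by
    intro 𝔭 h𝔭
    simp only [Finset.mem_union, not_or] at h𝔭
    have h𝔭3 : (3 : 𝓞 (CyclotomicField 3 ℚ)) ∉ 𝔭.asIdeal := fun h =>
      h𝔭.2 (hS₀ 𝔭 (by rwa [Nat.cast_ofNat]))
    exact primaryGen_unique h𝔭3 (hϖ 𝔭 h𝔭.1).1 (hρ 𝔭 h𝔭.2).1.1 (hϖ 𝔭 h𝔭.1).2 (hρ 𝔭 h𝔭.2).1.2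
  -- the given tower, read off `S ∪ S₀`, is an ORDINARY polarized tower for the trace function of ρ
  have havat : OrdPolarizedTower art hcpt ι c₀ (S ∪ S₀) (fun 𝔭 => e (↑(picardTrace f 𝔭 * ϖ' 𝔭))) := by
    intro k
    obtain ⟨P, r, hreg, hcsd, hP, hord⟩ := htower k
    refine ⟨P, r, hreg, hcsd, fun 𝔭 h𝔭 => ?_, hord⟩
    have h𝔭S : 𝔭 ∉ S := fun h => h𝔭 (Finset.mem_union_left _ h)
    obtain ⟨hunr, hcomp, α, t, hα, ht, hnorm⟩ := hP 𝔭 h𝔭S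
    refine ⟨hunr, hcomp, α, t, hα, ?_, hnorm⟩
    dsimp only at ht ⊢
    rw [← hϖeq 𝔭 h𝔭]
    exact ht
  -- Stub 4 in linked form (landed, conditional on the three Arthur–Clozel facts): L, S_L, the map
  obtain ⟨L, _instF, _instNF, _instA, s, c, hcptL, S_L, hCM, hs, hdegL, hcs, hcc₀, hSL3, hSLS₀, hSLS, hmap⟩ :=
    stub_baseChangeToL_linked hBCc hBCu hBCa ι hcpt c₀ hc₀ (S ∪ S₀) S₀
      (fun 𝔭 => e (↑(picardTrace f 𝔭 * ϖ' 𝔭))) ρ hS₀ (fun 𝔭 h𝔭 => (hρ 𝔭 h𝔭).2)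
  -- the linked heart, fed the K-side ordinary tower and the base-change map: ρ is automorphic over K
  obtain ⟨π', S'', hLalg, hcompat⟩ :=
    hHeart art f hcpt hdeg hsep hgal ι e S₀ ϖ' ρ hS₀ hρ c₀ (S ∪ S₀) havat Finset.subset_union_right L s c
      hcptL S_L hCM hc₀ hs hdegL hcs hcc₀ (hirr L hdegL) hSL3 hSLS₀ hSLS hmap
  -- Stub 6 (landed, unconditional): untwist, in sum form
  obtain ⟨πK, hKalg, hev⟩ :=
    stub_irregularDescentUntwist f hcpt hdeg hsep hgal ι e S₀ ϖ' ρ hS₀ hρ π' S'' hLalg hcompat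
  exact ⟨e, πK, hKalg, hev⟩

/-! ## 4. The re-routed deciding theorem -/

/-- The residual hypothesis from the two residual branches of the CURRENT route (their conclusions are
`ResidualHyp f hcpt` verbatim). -/
theorem residualHyp_of_branches (hOdd : ResidualAutomorphyOdd) (hEven : ResidualAutomorphyEven)
    (f : ℤ[X]) (hcpt : isCompact_glFiniteIntegralLevel 3 (CyclotomicField 3 ℚ))
    (hdeg : f.natDegree = 4) (hsep : (f.map (Int.castRingHom ℚ)).Separable)
    (hgal : 12 ∣ Nat.card (f.map (Int.castRingHom ℚ)).Gal) : ResidualHyp f hcpt := by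
  by_cases h4 : (f.map (Int.castRingHom ℝ)).roots.card = 4
  · exact hEven f hcpt hdeg hsep hgal h4
  · exact hOdd f hcpt hdeg hsep hgal h4

/-- **The re-routed items imply the TARGET**: fix local Artin data (`nonempty_artinData`); split on the aligned
μ-ordinary class of `f`; inside, 13757ᵒʳᵈ (fed the residual branches) then 13758ᵒʳᵈ; outside, the basic branch. -/
theorem picardAutomorphy_of_ord (hOdd : ResidualAutomorphyOdd) (hEven : ResidualAutomorphyEven)
    (hRT : MuOrdinaryFamilyRTOrd) (hCl : IrregularClassicalityOrd) (hB : BasicLocusAutomorphy) :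
    PicardAutomorphy := by
  intro f hcpt hdeg hsep hgal
  obtain ⟨art⟩ := nonempty_artinData
  by_cases hμ : MuOrdinaryClass art f
  · exact hCl art f hcpt hdeg hsep hgal
      (hRT art f hcpt hdeg hsep hgal hμ (residualHyp_of_branches hOdd hEven f hcpt hdeg hsep hgal))
  · exact hB art f hcpt hdeg hsep hgal hμ (residualHyp_of_branches hOdd hEven f hcpt hdeg hsep hgal)

/-- **`closes_ord` — the re-routed deciding theorem** (shape of the current `closes`, one hypothesis more):
`ResidualAutomorphyOdd → ResidualAutomorphyEven → MuOrdinaryFamilyRTOrd → IrregularClassicalityOrd →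
BasicLocusAutomorphy → SectorComplement → Langlands`. -/
theorem closes_ord (hOdd : ResidualAutomorphyOdd) (hEven : ResidualAutomorphyEven)
    (hRT : MuOrdinaryFamilyRTOrd) (hCl : IrregularClassicalityOrd) (hB : BasicLocusAutomorphy)
    (hC : SectorComplement) : _root_.Langlands :=
  hC (picardAutomorphy_of_ord hOdd hEven hRT hCl hB)

end

end Summit.Langlands.Langlands.Theorems.IrregularClassicality.SplitRamifiedPrimeSqrt6
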